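import Summits.ValiantsHypothesis.ValiantsHypothesis.Theorems.KPlusLogSqLawWindowDescartesKernelWindow

/-!
# The WINDOW DESCARTES RULE (GAP-LIFT §7): sign changes between two archimedean dominance points

Seat val-sym-lift-p4 (g2), cell `pub-symmetroid`, 2026-08-26.  The «window localisation» half of the technique named in the
docstring of the plan-only rung `stub_weakLiftRungEdge` of the `WeakLifting` skeleton (stmt-ValiantsHypothesis-19561;
HOME/val-sym-lift-p4/GAP-LIFT.md §7, where it is stated with a proof via Laurent series).  THEOREM
(`window_descartes_sgnChanges`): let `f` be a real polynomial, `0 < a < b`, `p < q`, and suppose the monomial of degree `p`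
DOMINATES `f` at `a` and the monomial of degree `q` dominates `f` at `b` (`∑_{s ≠ p} |coeff f s| a^s < |coeff f p| a^p`,
`∑_{s ≠ q} |coeff f s| b^s < |coeff f q| b^q`); then along every strictly increasing list of points of the open window `(a, b)`
the values of `f` change sign at most `V(coeff f p, …, coeff f q)` times (sign changes of the coefficient WINDOW, zeros
ignored).  Summing over consecutive dominance points recovers Descartes' bound, so the rule DISTRIBUTES Descartes' count over
the archimedean Newton polygon; between two consecutive dominant monomials of opposite sign it allows exactly one sign change.
PROOF (finite, no series): the truncated smoothing `Q_M = ∑_{i ≤ M} f(a) a^(M+1-i) X^i + X^(M+1)·P + ∑_{N < k ≤ N+M+1}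
f(b) b⁻¹^k X^(M+1+k)` satisfies `(x - a)(b - x) Q_M(x) = (b - a) x^(M+2) f(x) − a^(M+2) f(a)(b - x) − b⁻¹^(N+M+1) f(b)(x - a)
x^(2M+N+3)` (`…WindowDescartesKernelWindow.kernel_identity` + two geometric sums), so for `M` large `Q_M` has the sign of `f` at
the finitely many sample points; Descartes' rule (Mathlib `Polynomial.roots_countP_pos_le_signVariations`, through
`sgnChanges_eval_le_signVariations`) bounds the sign changes of its values by `signVariations Q_M`; and the coefficient list
of `Q_M` is `[top block, sign of coeff f q] ++ [H N, …, H 0] ++ [bottom block, sign of coeff f p]`, whose number of sign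
changes is that of `H q, …, H p` (`kernel_low_pos`, `kernel_high_pos`), at most `V(coeff f q, …, coeff f p)` by
`sgnChanges_kernel_window_le`.  HONEST FRAMING: a theorem about real polynomials; the distinct-zero form, the chain form
along the archimedean Newton polygon and the near-tropical lifting statement for pencils are sequels; nothing here asserts
`WeakLifting`, `TropicalB`, Conjecture B, `MatrixDescartes` (stmt-ValiantsHypothesis-18050) or anything on VP ≠ VNP.
[this file's theorem; ancestor: Laguerre's one-sided rules, Pólya–Szegő, Problems and Theorems in Analysis II, Part V, Ch. 1, §3]
-/

set_option linter.dupNamespace false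
set_option autoImplicit false

namespace Summit.ValiantsHypothesis.ValiantsHypothesis.Theorems.KPlusLogSqLaw.WindowDescartes

open Polynomial

/-! ## 8. The window Descartes rule

For a real polynomial `f` with coefficients `c`, points `0 < a < b` and indices `p < q` such that the monomial `c p X^p`
DOMINATES at `a` (`∑_{s ≠ p} |c s| a^s < |c p| a^p`) and `c q X^q` dominates at `b`, the values of `f` along any increasing
list of points of the open window `(a, b)` change sign at most `V(c p, …, c q)` times.  Proof: the truncated smoothing
`Q_M = ∑_{i ≤ M} f(a) a^(M+1-i) X^i + X^(M+1) P + ∑_{N < k ≤ N+M+1} f(b) b⁻¹^k X^(M+1+k)` satisfies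
`(x-a)(b-x) Q_M(x) = (b-a) x^(M+2) f(x) − a^(M+2) f(a) (b-x) − b⁻¹^(N+M+1) f(b) (x-a) x^(2M+N+3)`, so for `M` large it has
the sign of `f` at the finitely many sample points; Descartes' rule (Mathlib) bounds the sign changes of its values by
`signVariations Q_M`, and the coefficient list of `Q_M` is `[top block of sign c q] ++ [H N, …, H 0] ++ [bottom block of
sign c p]`, whose sign changes are those of `H q, …, H p`, at most `V(c q, …, c p)` by the kernel lemma. -/

section Window

variable {a b : ℝ}

/-- uniform choice of a threshold over a finite list. -/
theorem exists_forall_ge_of_forall_mem {P : ℕ → ℝ → Prop} (l : List ℝ)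
    (h : ∀ x ∈ l, ∃ M₀ : ℕ, ∀ M, M₀ ≤ M → P M x) : ∃ M₀ : ℕ, ∀ M, M₀ ≤ M → ∀ x ∈ l, P M x := by
  induction l with
  | nil => exact ⟨0, fun M _ x hx => absurd hx List.not_mem_nil⟩
  | cons y l ih =>
    obtain ⟨M₁, h₁⟩ := h y List.mem_cons_self
    obtain ⟨M₂, h₂⟩ := ih (fun x hx => h x (List.mem_cons_of_mem _ hx))
    refine ⟨max M₁ M₂, fun M hM x hx => ?_⟩
    rcases List.mem_cons.mp hx with rfl | hx
    · exact h₁ M ((le_max_left _ _).trans hM)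
    · exact h₂ M ((le_max_right _ _).trans hM) x hx

/-- sign congruence of two maps along a list. -/
theorem forall₂_map_of_forall {l : List ℝ} {g₁ g₂ : ℝ → ℝ} (h : ∀ x ∈ l, SignType.sign (g₁ x) = SignType.sign (g₂ x)) :
    List.Forall₂ (fun u v => SignType.sign u = SignType.sign v) (l.map g₁) (l.map g₂) := by
  induction l with
  | nil => exact List.Forall₂.nil
  | cons y l ih =>
    exact List.Forall₂.cons (h y List.mem_cons_self) (ih fun x hx => h x (List.mem_cons_of_mem _ hx))

/-- `firstNZ` of the reversed `slist` is the bottom entry when that entry is non-zero. -/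
theorem firstNZ_reverse_slist_of_ne_zero {h : ℕ → ℝ} {n : ℕ} (h0 : h 0 ≠ 0) : firstNZ (slist h n).reverse = h 0 := by
  rw [← slist_reflect]
  have e : h 0 = (fun j => h (n - j)) n := by simp
  rw [e]
  exact firstNZ_slist_of_ne_zero (by simpa using h0)

/-- **The window Descartes rule (sign-change form).**  Let `f` be a real polynomial, `0 < a < b`, `p < q`, and suppose the
monomial of degree `p` dominates `f` at `a` and the monomial of degree `q` dominates `f` at `b`:
`∑_{s ≠ p} |coeff f s| a^s < |coeff f p| a^p` and `∑_{s ≠ q} |coeff f s| b^s < |coeff f q| b^q` (sums over `s ≤ N`, any `N ≥ natDegree f`).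
Then along any strictly increasing list of points of the open window `(a, b)` the values of `f` change sign at most as many
times as the coefficient block `coeff f q, …, coeff f p` does. [this file's theorem; ancestors: Laguerre's extension of
Descartes' rule (zeros in `(0, a)` / `(a, ∞)` via partial sums), Pólya–Szegő, Problems and Theorems in Analysis II, Part V,
Ch. 1, §3] -/
theorem window_descartes_sgnChanges (f : ℝ[X]) {N : ℕ} (hN : f.natDegree ≤ N) (ha : 0 < a) (hab : a < b)
    {p q : ℕ} (hpq : p < q)
    (hda : ∑ s ∈ (Finset.range (N + 1)).erase p, |f.coeff s| * a ^ s < |f.coeff p| * a ^ p)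
    (hdb : ∑ s ∈ (Finset.range (N + 1)).erase q, |f.coeff s| * b ^ s < |f.coeff q| * b ^ q)
    (xs : List ℝ) (hsort : xs.Pairwise (· < ·)) (hxa : ∀ x ∈ xs, a < x) (hxb : ∀ x ∈ xs, x < b) :
    sgnChanges (xs.map fun x => f.eval x) ≤ sgnChanges (slist (fun i => f.coeff (p + i)) (q - p)) := by
  have hb : 0 < b := ha.trans hab
  have hb0 : b ≠ 0 := hb.ne'
  have ha0 : a ≠ 0 := ha.ne'
  set c : ℕ → ℝ := fun s => f.coeff s with hc
  -- non-vanishing of the two dominant coefficients, hence `p, q ≤ N`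
  have hcp : c p ≠ 0 := by
    intro h0; simp only [hc] at h0; rw [h0, abs_zero, zero_mul] at hda
    exact absurd hda (not_lt.mpr (Finset.sum_nonneg fun s _ => mul_nonneg (abs_nonneg _) (pow_nonneg ha.le _)))
  have hcq : c q ≠ 0 := by
    intro h0; simp only [hc] at h0; rw [h0, abs_zero, zero_mul] at hdb
    exact absurd hdb (not_lt.mpr (Finset.sum_nonneg fun s _ => mul_nonneg (abs_nonneg _) (pow_nonneg hb.le _)))
  have hpN : p ≤ N := (le_natDegree_of_ne_zero hcp).trans hN
  have hqN : q ≤ N := (le_natDegree_of_ne_zero hcq).trans hN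
  -- the smoothed coefficients
  set H : ℕ → ℝ := fun k => ∑ s ∈ Finset.range (N + 1), c s * (if s ≤ k then b⁻¹ ^ (k - s) else a ^ (s - k)) with hH
  have hlow : ∀ k, k ≤ p → 0 < c p * H k := fun k hk => kernel_low_pos ha hab c N p hpN hda k hk
  have hhigh : ∀ k, q ≤ k → 0 < c q * H k := fun k hk => kernel_high_pos ha hab c N q hqN hdb k hk
  set fa := f.eval a with hfa
  set fb := f.eval b with hfb
  have hf_sum : ∀ x, f.eval x = ∑ s ∈ Finset.range (N + 1), c s * x ^ s := fun x =>
    Polynomial.eval_eq_sum_range' (Nat.lt_succ_of_le hN) x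
  have hH0 : H 0 = fa := by
    rw [hfa, hf_sum]; simp only [hH]
    refine Finset.sum_congr rfl fun s _ => ?_
    rcases Nat.eq_zero_or_pos s with rfl | hs
    · simp
    · rw [if_neg (by omega), Nat.sub_zero]
  have hHN : H N = b⁻¹ ^ N * fb := by
    rw [hfb, hf_sum, Finset.mul_sum]; simp only [hH]
    refine Finset.sum_congr rfl fun s hs => ?_
    rw [Finset.mem_range] at hs
    rw [if_pos (by omega), inv_pow_eq_inv_pow_mul_pow hb0 (show N - s ≤ N by omega), show N - (N - s) = s by omega]
    ring
  have hfa_pos : 0 < c p * fa := by rw [← hH0]; exact hlow 0 (Nat.zero_le _)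
  have hfb_pos : 0 < c q * fb := by
    have h1 := hhigh N hqN
    rw [hHN, ← mul_assoc, mul_comm (c q), mul_assoc] at h1
    exact pos_of_mul_pos_right h1 (pow_nonneg (inv_nonneg.mpr hb.le) _)
  have hfa0 : fa ≠ 0 := fun h0 => by rw [h0, mul_zero] at hfa_pos; exact lt_irrefl _ hfa_pos
  have hfb0 : fb ≠ 0 := fun h0 => by rw [h0, mul_zero] at hfb_pos; exact lt_irrefl _ hfb_pos
  -- Step 1: discard the sample points where `f` vanishes
  set xs' := xs.filter (fun x => f.eval x ≠ 0) with hxs'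
  have hred : sgnChanges (xs.map fun x => f.eval x) = sgnChanges (xs'.map fun x => f.eval x) := by
    rw [← sgnChanges_filter_ne_zero, List.filter_map]; rfl
  have hsort' : xs'.Pairwise (· < ·) := hsort.filter _
  have hxa' : ∀ x ∈ xs', a < x := fun x hx => hxa x (List.mem_of_mem_filter hx)
  have hxb' : ∀ x ∈ xs', x < b := fun x hx => hxb x (List.mem_of_mem_filter hx)
  have hne' : ∀ x ∈ xs', f.eval x ≠ 0 := fun x hx => by simpa using (List.mem_filter.mp hx).2
  -- Step 2: the truncated smoothing `Q M` and its coefficients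
  let γ : ℕ → ℕ → ℝ := fun M i =>
    if i ≤ M then fa * a ^ (M + 1 - i) else if i ≤ M + 1 + N then H (i - (M + 1)) else fb * b⁻¹ ^ (i - (M + 1))
  let Q : ℕ → ℝ[X] := fun M => ∑ i ∈ Finset.range (2 * M + N + 3), Polynomial.monomial i (γ M i)
  have hQcoeff : ∀ M i, (Q M).coeff i = if i < 2 * M + N + 3 then γ M i else 0 := by
    intro M i
    simp only [Q, Polynomial.finsetSum_coeff, Polynomial.coeff_monomial, Finset.sum_ite_eq', Finset.mem_range]
  have hQdeg : ∀ M, (Q M).natDegree ≤ 2 * M + N + 2 := by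
    intro M
    rw [Polynomial.natDegree_le_iff_coeff_eq_zero]
    intro i hi
    rw [hQcoeff, if_neg (by exact_mod_cast (show ¬ (i < 2 * M + N + 3) by exact_mod_cast (by omega)))]
  have hQeval : ∀ M x, (Q M).eval x = ∑ i ∈ Finset.range (2 * M + N + 3), γ M i * x ^ i := by
    intro M x
    simp only [Q, Polynomial.eval_finsetSum, Polynomial.eval_monomial]
  -- Step 3: the identity `(x-a)(b-x) Q_M(x) = (b-a) x^(M+2) f(x) - a^(M+2) f(a) (b-x) - b⁻¹^(N+M+1) f(b) (x-a) x^(2M+N+3)`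
  have hident : ∀ M x, (x - a) * (b - x) * (Q M).eval x
      = (b - a) * x ^ (M + 2) * f.eval x - a ^ (M + 2) * fa * (b - x) - b⁻¹ ^ (N + M + 1) * fb * (x - a) * x ^ (2 * M + N + 3) := by
    intro M x
    rw [hQeval, Finset.range_eq_Ico,
      ← Finset.sum_Ico_consecutive _ (Nat.zero_le (M + 2 + N)) (by omega : M + 2 + N ≤ 2 * M + N + 3),
      ← Finset.sum_Ico_consecutive _ (Nat.zero_le (M + 1)) (by omega : M + 1 ≤ M + 2 + N)]
    set B1 := ∑ i ∈ Finset.Ico 0 (M + 1), γ M i * x ^ i with hB1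
    set B2 := ∑ i ∈ Finset.Ico (M + 1) (M + 2 + N), γ M i * x ^ i with hB2
    set B3 := ∑ i ∈ Finset.Ico (M + 2 + N) (2 * M + N + 3), γ M i * x ^ i with hB3
    -- bottom block
    have h1 : (x - a) * B1 = fa * a * (x ^ (M + 1) - a ^ (M + 1)) := by
      have e : B1 = fa * a * ∑ i ∈ Finset.range (M + 1), x ^ i * a ^ (M + 1 - 1 - i) := by
        rw [hB1, Finset.mul_sum, ← Finset.range_eq_Ico]
        refine Finset.sum_congr rfl fun i hi => ?_
        rw [Finset.mem_range] at hi
        simp only [γ]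
        rw [if_pos (by omega), show M + 1 - i = (M + 1 - 1 - i) + 1 by omega, pow_succ]
        ring
      rw [e, show (x - a) * (fa * a * ∑ i ∈ Finset.range (M + 1), x ^ i * a ^ (M + 1 - 1 - i))
        = fa * a * ((∑ i ∈ Finset.range (M + 1), x ^ i * a ^ (M + 1 - 1 - i)) * (x - a)) by ring, geom_sum₂_mul]
    -- middle block
    have h2 : B2 = x ^ (M + 1) * ∑ k ∈ Finset.range (N + 1), H k * x ^ k := by
      rw [hB2, Finset.sum_Ico_eq_sum_range, show M + 2 + N - (M + 1) = N + 1 by omega, Finset.mul_sum]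
      refine Finset.sum_congr rfl fun k hk => ?_
      rw [Finset.mem_range] at hk
      simp only [γ]
      rw [if_neg (by omega), if_pos (by omega), show M + 1 + k - (M + 1) = k by omega, pow_add]
      ring
    have h2' : (b - x) * (x - a) * (∑ k ∈ Finset.range (N + 1), H k * x ^ k)
        = (b - a) * x * f.eval x - a * fa * (b - x) - fb * b⁻¹ ^ N * (x - a) * x ^ (N + 1) := by
      have hid := kernel_identity ha hab c N x
      rw [← hf_sum x, ← hf_sum a, ← hf_sum b] at hid
      simp only [hH]
      linarith [hid]
    -- top block
    have h3 : (b - x) * B3 = fb * b⁻¹ ^ N * x ^ (M + 2 + N) - fb * b⁻¹ ^ (N + M + 1) * x ^ (2 * M + N + 3) := by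
      have e : B3 = fb * b⁻¹ ^ (N + M + 1) * x ^ (M + 2 + N) * ∑ j ∈ Finset.range (M + 1), x ^ j * b ^ (M + 1 - 1 - j) := by
        rw [hB3, Finset.sum_Ico_eq_sum_range, show 2 * M + N + 3 - (M + 2 + N) = M + 1 by omega, Finset.mul_sum]
        refine Finset.sum_congr rfl fun j hj => ?_
        rw [Finset.mem_range] at hj
        simp only [γ]
        rw [if_neg (by omega), if_neg (by omega), show M + 2 + N + j - (M + 1) = N + 1 + j by omega,
          inv_pow_eq_inv_pow_mul_pow hb0 (show N + 1 + j ≤ N + M + 1 by omega),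
          show N + M + 1 - (N + 1 + j) = M + 1 - 1 - j by omega, pow_add]
        ring
      have e2 : b ^ (M + 1) * b⁻¹ ^ ((M + 1) + N) = b⁻¹ ^ N := pow_mul_inv_pow_add hb0 (M + 1) N
      rw [show (M + 1) + N = N + M + 1 by ring] at e2
      rw [e, show (b - x) * (fb * b⁻¹ ^ (N + M + 1) * x ^ (M + 2 + N) * ∑ j ∈ Finset.range (M + 1), x ^ j * b ^ (M + 1 - 1 - j))
        = -(fb * b⁻¹ ^ (N + M + 1) * x ^ (M + 2 + N)) * ((∑ j ∈ Finset.range (M + 1), x ^ j * b ^ (M + 1 - 1 - j)) * (x - b)) by ring,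
        geom_sum₂_mul]
      linear_combination (fb * x ^ (M + 2 + N)) * e2
    rw [h2]
    linear_combination (b - x) * h1 + x ^ (M + 1) * h2' + (x - a) * h3
  -- Step 4: at a point of the window where `f ≠ 0`, `Q_M` has the sign of `f` for all large `M`
  have hsign : ∀ x ∈ xs', ∃ M₀ : ℕ, ∀ M, M₀ ≤ M → SignType.sign ((Q M).eval x) = SignType.sign (f.eval x) := by
    intro x hx
    have hax : a < x := hxa' x hx
    have hxb1 : x < b := hxb' x hx
    have hx0 : 0 < x := ha.trans hax
    have hfx : f.eval x ≠ 0 := hne' x hx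
    set θ := max (a / x) (x / b) with hθ
    have hθ1 : θ < 1 := max_lt ((div_lt_one hx0).mpr hax) ((div_lt_one hb).mpr hxb1)
    have hθ0 : 0 ≤ θ := le_max_of_le_left (div_nonneg ha.le hx0.le)
    set D := |fa| * (b - x) + |fb| * (x - a) with hD
    have hD0 : 0 ≤ D := add_nonneg (mul_nonneg (abs_nonneg _) (by linarith)) (mul_nonneg (abs_nonneg _) (by linarith))
    have htarget : 0 < (b - a) * |f.eval x| := mul_pos (by linarith) (abs_pos.mpr hfx)
    -- choose M₀ with θ^(M₀) · D < (b - a) |f x|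
    obtain ⟨M₀, hM₀⟩ : ∃ M₀ : ℕ, θ ^ M₀ * D < (b - a) * |f.eval x| := by
      rcases hD0.eq_or_lt with hD00 | hDpos
      · exact ⟨0, by rw [← hD00, mul_zero]; exact htarget⟩
      · obtain ⟨n, hn⟩ := exists_pow_lt_of_lt_one (div_pos htarget hDpos) hθ1
        exact ⟨n, by rwa [lt_div_iff₀ hDpos] at hn⟩
    refine ⟨M₀, fun M hM => ?_⟩
    have hθM : θ ^ (M + 1) ≤ θ ^ M₀ := pow_le_pow_of_le_one hθ0 hθ1.le (by omega)
    -- the error term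
    set E := a ^ (M + 2) * fa * (b - x) + b⁻¹ ^ (N + M + 1) * fb * (x - a) * x ^ (2 * M + N + 3) with hE
    have hxM : 0 < x ^ (M + 2) := pow_pos hx0 _
    have hE1 : a ^ (M + 2) ≤ θ ^ (M + 1) * x ^ (M + 2) := by
      have e : a ^ (M + 2) = (a / x) ^ (M + 2) * x ^ (M + 2) := by
        rw [div_pow, div_mul_cancel₀ _ hxM.ne']
      rw [e]
      refine mul_le_mul_of_nonneg_right ?_ hxM.le
      calc (a / x) ^ (M + 2) ≤ (a / x) ^ (M + 1) :=
            pow_le_pow_of_le_one (div_nonneg ha.le hx0.le) ((div_lt_one hx0).mpr hax).le (by omega)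
        _ ≤ θ ^ (M + 1) := pow_le_pow_left₀ (div_nonneg ha.le hx0.le) (le_max_left _ _) _
    have hE2 : b⁻¹ ^ (N + M + 1) * x ^ (2 * M + N + 3) ≤ θ ^ (M + 1) * x ^ (M + 2) := by
      have e : b⁻¹ ^ (N + M + 1) * x ^ (2 * M + N + 3) = (x / b) ^ (N + M + 1) * x ^ (M + 2) := by
        rw [div_eq_mul_inv, mul_pow, show 2 * M + N + 3 = (N + M + 1) + (M + 2) by ring, pow_add]; ring
      rw [e]
      refine mul_le_mul_of_nonneg_right ?_ hxM.le
      calc (x / b) ^ (N + M + 1) ≤ (x / b) ^ (M + 1) :=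
            pow_le_pow_of_le_one (div_nonneg hx0.le hb.le) ((div_lt_one hb).mpr hxb1).le (by omega)
        _ ≤ θ ^ (M + 1) := pow_le_pow_left₀ (div_nonneg hx0.le hb.le) (le_max_right _ _) _
    have hEabs : |E| < (b - a) * x ^ (M + 2) * |f.eval x| := by
      calc |E| ≤ |a ^ (M + 2) * fa * (b - x)| + |b⁻¹ ^ (N + M + 1) * fb * (x - a) * x ^ (2 * M + N + 3)| := abs_add_le _ _
        _ = a ^ (M + 2) * |fa| * (b - x) + b⁻¹ ^ (N + M + 1) * x ^ (2 * M + N + 3) * |fb| * (x - a) := by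
            rw [abs_mul, abs_mul, abs_of_nonneg (pow_nonneg ha.le _), abs_of_nonneg (by linarith : 0 ≤ b - x),
              abs_mul, abs_mul, abs_mul, abs_of_nonneg (pow_nonneg (inv_nonneg.mpr hb.le) _),
              abs_of_nonneg (by linarith : 0 ≤ x - a), abs_of_nonneg (pow_nonneg hx0.le _)]
            ring
        _ ≤ θ ^ (M + 1) * x ^ (M + 2) * |fa| * (b - x) + θ ^ (M + 1) * x ^ (M + 2) * |fb| * (x - a) := by
            gcongr
        _ = x ^ (M + 2) * (θ ^ (M + 1) * D) := by rw [hD]; ring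
        _ ≤ x ^ (M + 2) * (θ ^ M₀ * D) := mul_le_mul_of_nonneg_left (mul_le_mul_of_nonneg_right hθM hD0) hxM.le
        _ < x ^ (M + 2) * ((b - a) * |f.eval x|) := mul_lt_mul_of_pos_left hM₀ hxM
        _ = (b - a) * x ^ (M + 2) * |f.eval x| := by ring
    -- conclude
    have hprod : (x - a) * (b - x) * (Q M).eval x = (b - a) * x ^ (M + 2) * f.eval x + (-E) := by
      rw [hident]; simp only [hE]; ring
    have hs1 : SignType.sign ((x - a) * (b - x) * (Q M).eval x) = SignType.sign (f.eval x) := by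
      rw [hprod, sign_add_eq_sign_of_abs_lt, sign_mul, sign_mul, sign_pos (by linarith : (0:ℝ) < b - a), sign_pos hxM,
        one_mul, one_mul]
      rw [abs_neg, abs_mul, abs_mul, abs_of_pos (by linarith : (0:ℝ) < b - a), abs_of_pos hxM]
      exact hEabs
    rw [sign_mul, sign_mul, sign_pos (by linarith : (0:ℝ) < x - a), sign_pos (by linarith : (0:ℝ) < b - x), one_mul,
      one_mul] at hs1
    exact hs1
  obtain ⟨M₀, hM₀⟩ := exists_forall_ge_of_forall_mem (P := fun M x => SignType.sign ((Q M).eval x) = SignType.sign (f.eval x)) xs' hsign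
  set M := M₀ with hMdef
  have hsgn : ∀ x ∈ xs', SignType.sign ((Q M).eval x) = SignType.sign (f.eval x) := hM₀ M le_rfl
  -- Step 5: Descartes for `Q M` along the sample points
  have hQne : ∀ x ∈ xs', (Q M).eval x ≠ 0 := fun x hx h0 => by
    have := hsgn x hx; rw [h0, sign_zero] at this
    exact hne' x hx (sign_eq_zero_iff.mp this.symm)
  have hxpos : ∀ x ∈ xs', 0 < x := fun x hx => ha.trans (hxa' x hx)
  have step5 : sgnChanges (xs'.map fun x => f.eval x) ≤ (Q M).signVariations := by
    rw [← sgnChanges_congr (forall₂_map_of_forall hsgn)]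
    exact sgnChanges_eval_le_signVariations (Q M) xs' hsort' hxpos hQne
  -- Step 6: the coefficient list of `Q M`
  have step6a : (Q M).signVariations = sgnChanges (slist (γ M) (2 * M + N + 2)) := by
    rw [signVariations_eq_sgnChanges_slist (Q M) (hQdeg M)]
    congr 1
    exact slist_congr fun i hi => by rw [hQcoeff, if_pos (by omega)]
  -- (i) the top block has the sign of `H N`
  have hγtop : γ M (M + 1 + N) = H N := by
    simp only [γ]; rw [if_neg (by omega), if_pos le_rfl, Nat.add_sub_cancel_left]
  have hHN0 : H N ≠ 0 := fun h0 => by have := hhigh N hqN; rw [h0, mul_zero] at this; exact lt_irrefl _ this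
  have step6b : sgnChanges (slist (γ M) (2 * M + N + 2)) = sgnChanges (slist (γ M) (M + 1 + N)) := by
    rw [show 2 * M + N + 2 = (M + 1 + N) + (M + 1) by ring]
    refine sgnChanges_slist_add_of_sameSign_top (γ M) (M + 1 + N) (M + 1) (by rwa [hγtop]) fun i hi1 hi2 => ?_
    rw [hγtop]
    simp only [γ]
    rw [if_neg (by omega), if_neg (by omega)]
    -- `fb · b⁻¹^_ · H N > 0`: `fb` and `H N` both have the sign of `c q`
    have h1 : 0 < (c q * fb) * (c q * H N) := mul_pos hfb_pos (hhigh N hqN)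
    have h2 : 0 < fb * H N := by
      have e : (c q * fb) * (c q * H N) = c q ^ 2 * (fb * H N) := by ring
      rw [e] at h1
      exact pos_of_mul_pos_right h1 (sq_nonneg _)
    have h3 : 0 < b⁻¹ ^ (i - (M + 1)) := pow_pos (inv_pos.mpr hb) _
    calc (0:ℝ) < b⁻¹ ^ (i - (M + 1)) * (fb * H N) := mul_pos h3 h2
      _ = fb * b⁻¹ ^ (i - (M + 1)) * H N := by ring
  -- (ii) the bottom block has the sign of `H 0 = f a`
  have step6c : sgnChanges (slist (γ M) (M + 1 + N)) = sgnChanges (slist H N) := by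
    rw [show M + 1 + N = M + N + 1 by ring, slist_add]
    have emid : slist (fun k => γ M (M + 1 + k)) N = slist H N :=
      slist_congr fun k hk => by simp only [γ]; rw [if_neg (by omega), if_pos (by omega), Nat.add_sub_cancel_left]
    rw [emid]
    have hH00 : H 0 ≠ 0 := by rw [hH0]; exact hfa0
    refine sgnChanges_append_right_of_sameSign _ _ (by rw [firstNZ_reverse_slist_of_ne_zero hH00]; exact hH00) ?_
    intro z hz
    rw [firstNZ_reverse_slist_of_ne_zero hH00, hH0]
    obtain ⟨i, hi, rfl⟩ := mem_slist_iff.mp hz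
    simp only [γ]
    rw [if_pos hi]
    have : 0 < a ^ (M + 1 - i) := pow_pos ha _
    calc (0:ℝ) < a ^ (M + 1 - i) * (fa * fa) := mul_pos this (mul_self_pos.mpr hfa0)
      _ = fa * a ^ (M + 1 - i) * fa := by ring
  -- (iii) inside `H`: the entries above `q` and below `p`
  have step6d : sgnChanges (slist H N) = sgnChanges (slist H q) := by
    obtain ⟨m, hm⟩ := Nat.exists_eq_add_of_le hqN
    rw [hm]
    have hHq0 : H q ≠ 0 := fun h0 => by have := hhigh q le_rfl; rw [h0, mul_zero] at this; exact lt_irrefl _ this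
    refine sgnChanges_slist_add_of_sameSign_top H q m hHq0 fun i hi1 _ => ?_
    have h1 : 0 < (c q * H i) * (c q * H q) := mul_pos (hhigh i hi1.le) (hhigh q le_rfl)
    have e : (c q * H i) * (c q * H q) = c q ^ 2 * (H i * H q) := by ring
    rw [e] at h1
    exact pos_of_mul_pos_right h1 (sq_nonneg _)
  have step6e : sgnChanges (slist H q) = sgnChanges (slist (fun k => H (p + k)) (q - p)) := by
    obtain ⟨n, rfl⟩ := Nat.exists_eq_add_of_le hpq.le
    rw [Nat.add_sub_cancel_left]
    rcases Nat.eq_zero_or_pos p with hp0 | hp0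
    · -- no bottom part
      subst hp0
      simp only [Nat.zero_add]
    · obtain ⟨p', hp'⟩ : ∃ p', p = p' + 1 := ⟨p - 1, by omega⟩
      have hHp0 : H p ≠ 0 := fun h0 => by have := hlow p le_rfl; rw [h0, mul_zero] at this; exact lt_irrefl _ this
      have e : slist H (p + n) = slist (fun k => H (p + k)) n ++ slist H p' := by
        rw [show p + n = p' + n + 1 by omega, slist_add]
        congr 1
        exact slist_congr fun k _ => by rw [hp']
      rw [e]
      have h0' : (fun k => H (p + k)) 0 ≠ 0 := by simpa using hHp0
      refine sgnChanges_append_right_of_sameSign _ _ (by rw [firstNZ_reverse_slist_of_ne_zero h0']; exact h0') ?_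
      intro z hz
      rw [firstNZ_reverse_slist_of_ne_zero h0']
      obtain ⟨i, hi, rfl⟩ := mem_slist_iff.mp hz
      show 0 < H i * H (p + 0)
      rw [Nat.add_zero]
      have h1 : 0 < (c p * H i) * (c p * H p) := mul_pos (hlow i (by omega)) (hlow p le_rfl)
      have e2 : (c p * H i) * (c p * H p) = c p ^ 2 * (H i * H p) := by ring
      rw [e2] at h1
      exact pos_of_mul_pos_right h1 (sq_nonneg _)
  -- (iv) the kernel lemma on the window block
  have step6f : sgnChanges (slist (fun k => H (p + k)) (q - p)) ≤ sgnChanges (slist (fun i => c (p + i)) (q - p)) :=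
    sgnChanges_kernel_window_le ha hab c N p q hpq hqN hda hdb
  -- assemble
  calc sgnChanges (xs.map fun x => f.eval x) = sgnChanges (xs'.map fun x => f.eval x) := hred
    _ ≤ (Q M).signVariations := step5
    _ = sgnChanges (slist (γ M) (2 * M + N + 2)) := step6a
    _ = sgnChanges (slist (γ M) (M + 1 + N)) := step6b
    _ = sgnChanges (slist H N) := step6c
    _ = sgnChanges (slist H q) := step6d
    _ = sgnChanges (slist (fun k => H (p + k)) (q - p)) := step6e
    _ ≤ sgnChanges (slist (fun i => c (p + i)) (q - p)) := step6f

end Window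

end Summit.ValiantsHypothesis.ValiantsHypothesis.Theorems.KPlusLogSqLaw.WindowDescartes
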